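import Mathlib
import Summits.ValiantsHypothesis.ValiantsHypothesis.Theses.ChowBorderDepth3
import Summits.ValiantsHypothesis.ValiantsHypothesis.Theorems.ChowBorderDepth3LocalFanInTwoFlattening
import Summits.ValiantsHypothesis.ValiantsHypothesis.Theorems.ChowBorderDepth3LocalFanInTwoPermMinor
import Summits.ValiantsHypothesis.ValiantsHypothesis.Theorems.ChowBorderDepth3LocalFanInTwoNewton

/-!
# `ChowBorderDepth3.LocalFanInTwo` (item stmt-ValiantsHypothesis-5938): two local border
# summands force `C(n,⌊n/2⌋)² ≤ 2D`

Route `ValiantsHypothesis/ChowBorderDepth3`, support item `LocalFanInTwo`: a two-summand local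
border expression

  `a_0(ε) Π_{j<D} (1 + m_{0j}) + a_1(ε) Π_{j<D} (1 + m_{1j}) = ε^q · per_n + ε^{q+1} · G`

over `ℂ[ε]`, with linear forms `m_{ij}` whose coefficients are divisible by `ε`, forces
`C(n,⌊n/2⌋)² ≤ 2D` (`n ≥ 1`).

## Proof

1. (`ε`-adic bookkeeping.) Constant terms give `a_0 + a_1 = ε^{q+1} g_0`, whence
   `a_0 (E_0 − E_1) = ε^q per_n + ε^{q+1} G'` for the two products `E_i`.  Writing
   `a_0 = ε^α a'` with `a'(0) ≠ 0` (the coefficient of the diagonal monomial shows `a_0 ≠ 0` and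
   `α ≤ q`), primality of `ε` in `ℂ[ε]` gives `E_0 − E_1 = ε^γ U'` (`γ = q − α`) with
   `a' U' = per_n + ε G'`, so `U'(0) = per_n / a'(0)`.
2. (Logarithm, `…Newton.psum_sub_psum_eq`.) Newton's identities turn this into
   `Σ_j m_{0j}^n − Σ_j m_{1j}^n = ε^γ Q` with `Q(0) = c · per_n`, `c = (−1)^{n+1} n / a'(0) ≠ 0`:
   a border Waring decomposition of `per_n` with `2D` summands.
3. (Flattening, `…PermMinor.exists_perPoly_flattening` and
   `…Flattening.card_le_card_of_border_powers`.) The middle catalecticant of `per_n` contains an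
   identity minor of size `C(n,⌊n/2⌋)²`, and catalecticant minors of that size of a border sum of
   `2D` powers of linear forms vanish unless `C(n,⌊n/2⌋)² ≤ 2D`.

References: J. M. Landsberg, *Geometry and complexity theory*, CUP 2017, §6.2 and §7.5.3;
M. Kumar, *On the power of border of depth-3 arithmetic circuits*, ACM ToCT 12 (2020)
(doi:10.1145/3371506); N. Nisan, A. Wigderson, Comput. Complexity 6 (1996/97), §3.
-/

noncomputable section

-- `Summit.ValiantsHypothesis.ValiantsHypothesis.…` is the tree's mandated single-conjunct layout
-- (Sub = Summit), so the duplicated namespace component is intended.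
set_option linter.dupNamespace false

namespace Summit.ValiantsHypothesis.ValiantsHypothesis.Theorems.ChowBorderDepth3LocalFanInTwo

open MvPolynomial Literature.Computability.AlgebraicComplexity

open scoped Polynomial

/-- `homogeneousComponent` commutes with a change of scalars. [folklore] -/
theorem map_homogeneousComponent {σ R S : Type*} [CommSemiring R] [CommSemiring S] (f : R →+* S)
    (k : ℕ) (φ : MvPolynomial σ R) :
    MvPolynomial.map f (homogeneousComponent k φ) = homogeneousComponent k (MvPolynomial.map f φ) := by
  ext d
  simp only [coeff_map, coeff_homogeneousComponent]
  split_ifs <;> simp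

/-- The generic permanent has no constant term for `n ≥ 1`. [folklore] -/
theorem constantCoeff_perPoly {n : ℕ} (hn : 1 ≤ n) : constantCoeff (perPoly (Fin n) ℂ) = 0 := by
  rw [constantCoeff_eq]
  refine (perPoly_isHomogeneous (n := Fin n) (k := ℂ)).coeff_eq_zero (d := 0) ?_
  rw [Fintype.card_fin, map_zero]
  omega

/-- **`LocalFanInTwo`** (item stmt-ValiantsHypothesis-5938 of route `ChowBorderDepth3`): a
two-summand local border expression
`Σ_{i<2} a_i(ε) Π_{j<D} (1 + Σ_v m_{ijv}(ε) x_v) = ε^q per_n + ε^{q+1} G` with `ε ∣ m_{ijv}` and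
`n ≥ 1` forces `C(n,⌊n/2⌋)² ≤ 2D`: taking logarithms (Newton's identities) the power sums
`p_n(m_0) − p_n(m_1)` degenerate to a non-zero multiple of `per_n` (border Waring rank
`≤ 2D`), and the middle catalecticant of `per_n` has an identity minor of size `C(n,⌊n/2⌋)²`
(Landsberg 2017 §6.2; Kumar 2020; Nisan–Wigderson 1996/97 §3). -/
theorem localFanInTwo_proof :
    Summit.ValiantsHypothesis.ValiantsHypothesis.Theses.ChowBorderDepth3.LocalFanInTwo := by
  intro n D q a m G hn hm H
  classical
  -- notation: the linear forms `L i j`, the products `E i`, the padded target `Per`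
  obtain ⟨L, hL⟩ : ∃ L : Fin 2 → Fin D → MvPolynomial (Fin n × Fin n) ℂ[X],
      ∀ i j, L i j = ∑ v, C (m i j v) * X v := ⟨_, fun _ _ => rfl⟩
  simp only [← hL] at H
  set Per : MvPolynomial (Fin n × Fin n) ℂ[X] :=
    MvPolynomial.map Polynomial.C (perPoly (Fin n) ℂ) with hPer
  have hL0 : ∀ i j, constantCoeff (L i j) = 0 := by
    intro i j
    rw [hL, map_sum]
    exact Finset.sum_eq_zero fun v _ => by simp [constantCoeff_X]
  have hE0 : ∀ i, constantCoeff (∏ j, (1 + L i j)) = 1 := by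
    intro i
    rw [map_prod]
    exact Finset.prod_eq_one fun j _ => by rw [map_add, map_one, hL0, add_zero]
  have hPer0 : constantCoeff Per = 0 := by
    rw [hPer, constantCoeff_map, constantCoeff_perPoly hn, map_zero]
  -- Step 1: constant terms, `a 0 + a 1 = ε^{q+1} g₀`
  set g₀ : ℂ[X] := constantCoeff G with hg₀
  have ha01 : a 0 + a 1 = Polynomial.X ^ (q + 1) * g₀ := by
    have h0 := congrArg constantCoeff H
    rw [map_sum, Fin.sum_univ_two, map_mul, map_mul, constantCoeff_C, constantCoeff_C, hE0, hE0,
      mul_one, mul_one, map_add, map_mul, map_mul, constantCoeff_C, constantCoeff_C, hPer0,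
      mul_zero, zero_add] at h0
    exact h0
  -- Step 2: `a 0 · (E 0 - E 1) = ε^q Per + ε^{q+1} G'`
  set U : MvPolynomial (Fin n × Fin n) ℂ[X] := ∏ j, (1 + L 0 j) - ∏ j, (1 + L 1 j) with hUdef
  set G' : MvPolynomial (Fin n × Fin n) ℂ[X] := G - C g₀ * ∏ j, (1 + L 1 j) with hG'
  have hU : C (a 0) * U = C (Polynomial.X ^ q) * Per + C (Polynomial.X ^ (q + 1)) * G' := by
    rw [Fin.sum_univ_two] at H
    have ha1 : (C (a 1) : MvPolynomial (Fin n × Fin n) ℂ[X]) =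
        C (Polynomial.X ^ (q + 1)) * C g₀ - C (a 0) := by
      rw [← map_mul, ← ha01, map_add]; ring
    rw [ha1] at H
    rw [hUdef, hG']
    linear_combination H
  -- Step 3: the diagonal coefficient: `a 0 ≠ 0`, and `a 0 = ε^α a'` with `a'(0) ≠ 0`, `α ≤ q`
  set d₀ : Fin n × Fin n →₀ ℕ := ∑ i, Finsupp.single (((1 : Equiv.Perm (Fin n)) i), i) 1 with hd₀
  have hPerd₀ : coeff d₀ Per = 1 := by
    rw [hPer, coeff_map, hd₀, coeff_perPoly_rho, map_one]
  have hcoef : a 0 * coeff d₀ U = Polynomial.X ^ q * (1 + Polynomial.X * coeff d₀ G') := by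
    have h0 := congrArg (coeff d₀) hU
    rw [coeff_C_mul, coeff_add, coeff_C_mul, coeff_C_mul, hPerd₀] at h0
    rw [h0]; ring
  have h1X : ¬ Polynomial.X ∣ (1 + Polynomial.X * coeff d₀ G') := by
    rw [Polynomial.X_dvd_iff, Polynomial.coeff_add, Polynomial.coeff_one_zero,
      Polynomial.coeff_X_mul_zero, add_zero]
    exact one_ne_zero
  have ha0 : a 0 ≠ 0 := by
    intro h
    rw [h, zero_mul, eq_comm, mul_eq_zero] at hcoef
    rcases hcoef with h' | h'
    · exact pow_ne_zero _ Polynomial.X_ne_zero h'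
    · exact h1X (h' ▸ dvd_zero _)
  obtain ⟨α, a', ha', hnd⟩ : ∃ (α : ℕ) (a' : ℂ[X]), a 0 = Polynomial.X ^ α * a' ∧
      ¬ Polynomial.X ∣ a' := by
    obtain ⟨a', h1, h2⟩ := Polynomial.exists_eq_pow_rootMultiplicity_mul_and_not_dvd (a 0) ha0 0
    rw [map_zero, sub_zero] at h1 h2
    exact ⟨(a 0).rootMultiplicity 0, a', h1, h2⟩
  have ha'0 : a'.coeff 0 ≠ 0 := fun h => hnd (Polynomial.X_dvd_iff.2 h)
  have hαq : α ≤ q := by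
    by_contra hlt
    rw [not_le] at hlt
    have hdvd : Polynomial.X ^ (q + 1) ∣ Polynomial.X ^ q * (1 + Polynomial.X * coeff d₀ G') := by
      rw [← hcoef, ha', mul_assoc]
      exact (pow_dvd_pow Polynomial.X hlt).mul_right _
    rw [pow_succ, mul_dvd_mul_iff_left (pow_ne_zero q Polynomial.X_ne_zero)] at hdvd
    exact h1X hdvd
  obtain ⟨γ, rfl⟩ : ∃ γ, q = α + γ := ⟨q - α, (Nat.add_sub_of_le hαq).symm⟩
  -- Step 4: cancel `ε^α`
  have hCX : ∀ k : ℕ, (C (Polynomial.X ^ k) : MvPolynomial (Fin n × Fin n) ℂ[X]) ≠ 0 := fun k =>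
    (C_eq_zero.not).2 (pow_ne_zero k Polynomial.X_ne_zero)
  have hU2 : C a' * U = C (Polynomial.X ^ γ) * Per + C (Polynomial.X ^ (γ + 1)) * G' := by
    refine mul_left_cancel₀ (hCX α) ?_
    rw [← mul_assoc, ← map_mul, ← ha', hU]
    simp only [pow_add, pow_succ, map_mul]
    ring
  -- Step 5: `ε^γ ∣ U` coefficientwise (primality of `ε`), `U = ε^γ U''`, `a' U'' = Per + ε G'`
  have hdvdU : C (Polynomial.X ^ γ) ∣ U := by
    rw [C_dvd_iff_dvd_coeff]
    intro d
    refine Polynomial.prime_X.pow_dvd_of_dvd_mul_left γ hnd ?_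
    have h0 := congrArg (coeff d) hU2
    rw [coeff_C_mul, coeff_add, coeff_C_mul, coeff_C_mul, pow_succ, mul_assoc, ← mul_add] at h0
    exact ⟨_, h0⟩
  obtain ⟨U'', hU''⟩ := hdvdU
  have hstar : C a' * U'' = Per + C Polynomial.X * G' := by
    refine mul_left_cancel₀ (hCX γ) ?_
    rw [mul_left_comm, ← hU'', hU2, pow_succ, map_mul]
    ring
  -- Step 6: Newton — the power sums degenerate to a multiple of `per_n`
  have hhom : ∀ i j, (L i j).IsHomogeneous 1 := by
    intro i j
    rw [hL]
    refine IsHomogeneous.sum _ _ _ fun v _ => ?_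
    have := (isHomogeneous_C (Fin n × Fin n) (m i j v)).mul (isHomogeneous_X ℂ[X] v)
    rwa [zero_add] at this
  have hdiv : ∀ i j, C Polynomial.X ∣ L i j := by
    intro i j
    rw [hL]
    exact Finset.dvd_sum fun v _ => (map_dvd C (hm i j v)).mul_right _
  obtain ⟨W, hW⟩ := psum_sub_psum_eq Polynomial.X γ (L 0) (L 1) (hhom 0) (hhom 1) (hdiv 0)
    (hdiv 1) U'' (by rw [← hU'']) hn
  -- the value of `U''` at `ε = 0`
  have hU''0 : MvPolynomial.map Polynomial.constantCoeff U'' = C (a'.coeff 0)⁻¹ * perPoly (Fin n) ℂ := by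
    have h0 := congrArg (MvPolynomial.map Polynomial.constantCoeff) hstar
    rw [map_mul, map_C, map_add, map_mul, map_C, Polynomial.constantCoeff_apply,
      Polynomial.constantCoeff_apply, Polynomial.coeff_X_zero, C_0, zero_mul, add_zero, hPer,
      map_map] at h0
    have hid : Polynomial.constantCoeff.comp Polynomial.C = RingHom.id ℂ := by
      ext x; simp
    rw [hid, map_id] at h0
    rw [← h0, ← mul_assoc, ← map_mul, inv_mul_cancel₀ ha'0, C_1, one_mul]
  set c : ℂ := (-1) ^ (n + 1) * n * (a'.coeff 0)⁻¹ with hc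
  have hc0 : c ≠ 0 := by
    refine mul_ne_zero (mul_ne_zero (pow_ne_zero _ (neg_ne_zero.2 one_ne_zero)) ?_)
      (inv_ne_zero ha'0)
    exact_mod_cast (show n ≠ 0 by omega)
  have hQ : MvPolynomial.map Polynomial.constantCoeff
      ((-1 : MvPolynomial (Fin n × Fin n) ℂ[X]) ^ (n + 1) * (n : MvPolynomial _ ℂ[X]) *
        homogeneousComponent n U'' + C Polynomial.X * W) = C c * perPoly (Fin n) ℂ := by
    have hX0 : Polynomial.constantCoeff (Polynomial.X : ℂ[X]) = 0 := by
      rw [Polynomial.constantCoeff_apply, Polynomial.coeff_X_zero]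
    simp only [map_add, map_mul, map_pow, map_neg, map_one, map_natCast, map_C, hX0, C_0,
      zero_mul, add_zero, map_homogeneousComponent, hU''0, homogeneousComponent_C_mul]
    rw [homogeneousComponent_of_mem (perPoly_isHomogeneous (n := Fin n) (k := ℂ)),
      Fintype.card_fin, if_pos rfl, hc]
    simp only [map_mul, map_pow, map_neg, map_one, map_natCast]
    ring
  -- Step 7: the border Waring decomposition with `2D` summands, indexed by `Fin 2 × Fin D`
  have hsum : ∑ s : Fin 2 × Fin D, C (if s.1 = 0 then (1 : ℂ[X]) else -1) *
      (∑ v, C (m s.1 s.2 v) * X v : MvPolynomial (Fin n × Fin n) ℂ[X]) ^ n =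
      C (Polynomial.X ^ γ) * ((-1 : MvPolynomial (Fin n × Fin n) ℂ[X]) ^ (n + 1) *
        (n : MvPolynomial _ ℂ[X]) * homogeneousComponent n U'' + C Polynomial.X * W) := by
    rw [← hW, Fintype.sum_prod_type, Fin.sum_univ_two, sub_eq_add_neg, ← Finset.sum_neg_distrib]
    congr 1 <;> refine Finset.sum_congr rfl fun j _ => ?_ <;> dsimp only
    · rw [if_pos rfl, C_mul', one_smul, hL]
    · rw [if_neg (show (1 : Fin 2) ≠ 0 by decide), C_mul', neg_one_smul, hL]
  -- Step 8: the identity minor of the middle catalecticant of `per_n`, and the rank bound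
  obtain ⟨N, α', β', hN, hlen, hdet⟩ := exists_perPoly_flattening n (n / 2) (Nat.div_le_self n 2)
  have hle := card_le_card_of_border_powers (ρ := Fin N) (fun s : Fin 2 × Fin D =>
      if s.1 = 0 then (1 : ℂ[X]) else -1) (fun s v => m s.1 s.2 v) _ (perPoly (Fin n) ℂ) c hc0
    hsum hQ α' β' hlen hdet
  rw [Fintype.card_fin, Fintype.card_prod, Fintype.card_fin, Fintype.card_fin] at hle
  rw [← hN]
  exact hle

end Summit.ValiantsHypothesis.ValiantsHypothesis.Theorems.ChowBorderDepth3LocalFanInTwo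

end
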